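import Summits.HodgeConjecture.HodgeConjecture.Theorems.F0P3cStCharTSEllInnerAssembly     -- ★ (E8) p852664 (F0P3a-p06): letters `SH n γc eT heT tH m cQ σ hσm hσreg hσR hσpair hσexh hsingH hE0 hE0i` BY SHAPE; brings ★ UP-EVAL `finsum_quot_eq_sum`, ★ (A1′)-E/D currency
import Summits.HodgeConjecture.HodgeConjecture.Theorems.F0P3cStCharTSUpTrAssemblyFold     -- ★ (F2) p852579 (LH10-p01): brings ★ (P2) `…UpTrTransferSide` (`stableOrbitalIntegralRel` currency, the transfer-side fold)
import HarnessLib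

/-!
# F0 · P3c · ROAD «UP-TR» (A1″) «UP-TR-FULL», FILE U1 «SLOT TRANSPORT»: the elliptic part of the up-transfer identity WITHOUT local boundedness —
# `Σ_{T′ ∈ Sell} [N_G(T′):T′]⁻¹ ∫_{T′} D_G² · α^G · Φ_G(·, f) = Σ_{T ∈ SH} [N_H(T):T]⁻¹ (m T)⁻¹ ∫_T D_H² · α · Φ^st_H(·, f^H)` from (E0), the slot maps and (P2) AT EACH SLOT
# (Rogawski 1990 §12.5 pp. 182–185, Lemma 12.5.1; §4.3 (4.3.1))

Cell `pub/hodgecm-mathlib`, crux H413 = `stmt-HodgeConjecture-24833` (lane `--supports … --as helper`, count-neutral); seat F0P2-p01 (g25), author lineage of CENSUS (A1″)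
`F0/P2/p01/g24/uptr/CENSUS-A1pp.v1.F0P2p01g24.md` (LEAD T14-48 triggers met; LEAD-HANDOFF g15 §6 (iv)).  THEOREMS ONLY (no definition ∕ instance ∕ notation ∕ named fact ∕ `sorry`);
★-only imports; axioms TRIO.

THE MATHEMATICS.  `G = U(Φ₃)(L⁺_v)`, `H_v = U(Φ₂) × U(Φ₁)`, `v` non-split; `α` a stable class function on the `G`-regular elliptic set of `H_v`; `α^G` the up-transfer (UP-DEF, spelled
inline with ABSTRACT closed forms `dG`, `dH` exactly as ★ (A1′)-E ∕ ★ (E8)); `Φ_G(⟦·⟧, f) = classOrbitalIntegral mQv f`, `Φ^st_H(·, f^H) = stableOrbitalIntegralRel ∼_st mHv fH`.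
★ (A1′)-E∕F prove `∫_G f α^G = ∫_H f^H α` for the LOCALLY BOUNDED class (`D_H · α` locally bounded) by splitting the `G`-side integrand into its norm-fibre SLOT pieces `(T, i)` —
pieces that are NOT separately integrable under the printed hypotheses (★ (A0)'s design note: «integrals are never split below the torus»).  Here the elliptic part is done
WITHOUT splitting below the torus: (E0) «G-REGROUP» (`hE0`, `hE0i` BY SHAPE, ★ `F0P3cStCharTSEllInnerGRegroupPerT`) rewrites the `G`-side elliptic torus sum of the WHOLE torus
integrand `Ψ = D_G² · α^G · Φ_G(·,f)` as `Σ_{T ∈ SH} [N_H(T):T]⁻¹ (m T)⁻¹ (cQ T)⁻¹ Σ_i ∫_T Ψ(e_i s)`; POINTWISE at a `G`-regular `s ∈ T`, UP-EVAL on the slot transversal `{σ_u s}_u`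
(★ `finsum_quot_eq_sum`) and (P2) AT THE SLOT `σ_u s` on the embedding transversal `{e_i s}_i` (`hP2σ` BY SHAPE, ★ `…UpTrTransferSide.sum_weylDiscrThree_mul_upSummand_mul_classOrbitalIntegral_eq`)
give **`Σ_i Ψ(e_i s) = Σ_u F_H(σ_u s)`**, `F_H := D_H² · α · Φ^st_H(·, f^H)` — the `i`-sum and the `u`-sum are exchanged BEFORE integrating, so every cancellation between slots is
respected; then `∫_T F_H ∘ σ_u = ∫_T F_H` (`hσm`: the slot maps preserve `tH T`; `MeasurePreserving.integrable_comp`, `integral_map` — the only integrability used is that of the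
GIVEN totals `hIG` on `G`-tori, through (E0)'s transport companion, and `hIH` on `H`-tori), so the weight is `[N_H(T):T]⁻¹ (m T)⁻¹ (cQ T)⁻¹ · cQ T = [N_H(T):T]⁻¹ (m T)⁻¹` = ★ (A1′)-F's `cW T`.

* `ellipticTorusSum_upIntegrand_eq_of_inputs` — the statement above, from its named inputs BY SHAPE (letters = ★ (E8) `innerG_up_eq_two_mul_innerH_of_inputs` token for token where
  they coincide: `dG hdG dH hDHst SH n γc eT heT tH hZ hKH m hclasses Sell μTf cQ σ hσm hσreg hσR hσpair hσexh hnm hsingH hE0 hE0i`; new: `hP2σ`, `hIG`, `hIH` for ONE `α`).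
HONEST LABEL: count-neutral helper toward (A1″) (print's general-`α` clause 3 of [Rogawski1990 L. 12.5.1]); closes no organ; the UP-TR block consequent left the organ at ED. 26 on
the LB reading; HC_CM is proved only modulo the printed citations (hLiu418 24832 ∕ h413 24833) until rung 0 closes.

## References
* [Rogawski1990] J. D. Rogawski, *Automorphic Representations of Unitary Groups in Three Variables*, Ann. of Math. Stud. 123 (1990): §12.5 pp. 182–185 (Lemma 12.5.1 and its proof;
  the slots `w ∈ Ω_F(T,G)∖Ω_F(T,H)` p. 184), §4.3 (4.3.1) p. 43, §4.9 p. 55.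
* [LanglandsShelstad1987] R. P. Langlands, D. Shelstad, *On the definition of transfer factors*, Math. Ann. 278 (1987), §1.3.
-/

set_option autoImplicit false
-- the mandated namespace has the single-problem summit's repeated segment (`HodgeConjecture.HodgeConjecture`)
set_option linter.dupNamespace false

noncomputable section

open MeasureTheory Measure Set Filter Topology Function NumberField IsDedekindDomain Matrix
open Literature.MeasureTheory.Group
open Literature.NumberTheory.Automorphic Literature.NumberTheory.Automorphic.UnitaryGroup Literature.NumberTheory.Rogawski1990
open Literature.NumberTheory.GaloisRepresentations
open Summit.HodgeConjecture.HodgeConjecture.Cruxes.H413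
open Summit.HodgeConjecture.HodgeConjecture.Cruxes.H413.F0P3cStCharTSWeylCartanRadial
open Summit.HodgeConjecture.HodgeConjecture.Cruxes.H413.F0P3cStCharTSUpTrExchange
open Summit.HodgeConjecture.HodgeConjecture.Cruxes.H413.F0P3cStCharTSUpEval
open scoped ENNReal NNReal MatrixGroups Pointwise Classical

namespace Summit.HodgeConjecture.HodgeConjecture.Cruxes.H413.F0P3cStCharTSUpTrSlotTransport

/-! ## §1 Two algebra helpers -/

/-- `d² · (d⁻¹ · A) · B = d · A · B` — the Weyl radical `D_G² = dG²` against the `dG⁻¹` of `α^G`, one factor `dG` surviving into (P2)'s summand. [cite: Rogawski1990, §12.5 p. 183] -/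
theorem sq_mul_inv_mul_mul (d : ℝ) (A B : ℂ) : ((d : ℂ)) ^ 2 * (((d : ℂ))⁻¹ * A) * B = (d : ℂ) * A * B := by
  by_cases hd : (d : ℂ) = 0
  · rw [hd]; ring
  · field_simp

/-- The scalar bookkeeping of the slot transport: `(W⁻¹ · m⁻¹ · c⁻¹) · (c · I) = (W⁻¹ · m⁻¹) · I` (`c = cQ T ≠ 0` slots). [cite: Rogawski1990, §12.5 pp. 184–185] -/
theorem weight_mul_card_mul_eq (W m c : ℕ) (hc : c ≠ 0) (I : ℂ) :
    (((W : ℂ))⁻¹ * ((m : ℂ))⁻¹ * ((c : ℂ))⁻¹) * ((c : ℂ) * I) = (((W : ℂ))⁻¹ * ((m : ℂ))⁻¹) * I := by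
  have hc' : (c : ℂ) ≠ 0 := Nat.cast_ne_zero.2 hc
  calc (((W : ℂ))⁻¹ * ((m : ℂ))⁻¹ * ((c : ℂ))⁻¹) * ((c : ℂ) * I) = (((W : ℂ))⁻¹ * ((m : ℂ))⁻¹) * (((c : ℂ))⁻¹ * (c : ℂ)) * I := by ring
    _ = (((W : ℂ))⁻¹ * ((m : ℂ))⁻¹) * I := by rw [inv_mul_cancel₀ hc', mul_one]

/-! ## §2 The elliptic part of the up-transfer identity, from named inputs -/

section CM

variable (L : Type) [Field L] [NumberField L] [IsCMField L] (v : HeightOneSpectrum (𝓞 ↥(maximalRealSubfield L)))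

set_option maxHeartbeats 3200000 in
set_option synthInstance.maxHeartbeats 400000 in
-- long statement; instance-term unification on the CM local carriers (class of ★ (A1′)-E ∕ ★ (E8))
/-- **(A1″)-U1 «SLOT TRANSPORT» — the elliptic part of the up-transfer identity WITHOUT local boundedness, from named inputs.**  Letters of ★ (E8) `innerG_up_eq_two_mul_innerH_of_inputs`
where they coincide (`dG hdG dH hDHst SH n γc eT heT tH hZ hKH m hclasses Sell μTf cQ σ hσm hσreg hσR hσpair hσexh hnm hsingH hE0 hE0i`); NEW: `hP2σ` = ★ (P2) at each slot `σ_u s` on the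
embedding transversal `{e_i s}_i`, and the two GIVEN totals `hIG` (the `G`-torus integrand `dG² · α^G · Φ_G(⟦·⟧, f)` on every `T′ ∈ Sell`) and `hIH` (`dH² · α · Φ^st_H(·, f^H)` on every `T ∈ SH`).
THEN  `Σ_{T′ ∈ Sell} [N_G(T′):T′]⁻¹ ∫_{T′} dG² · α^G · Φ_G(⟦·⟧, f) ∂μTf = Σ_{T ∈ SH} [N_H(T):T]⁻¹ (m T)⁻¹ ∫_T dH² · α · Φ^st_H(·, f^H) ∂tH`, `α^G` = (UP-DEF) inline.
[cite: Rogawski1990, §12.5 pp. 182–185, Lemma 12.5.1; §4.3 (4.3.1) p. 43] [cite: LanglandsShelstad1987, §1.3] -/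
theorem ellipticTorusSum_upIntegrand_eq_of_inputs
    [MeasurableSpace (Gqs L v)] [BorelSpace (Gqs L v)]
    [MeasurableSpace ((UnitaryGroup.cmDatum L 2 (Matrix.of fun i j : Fin 2 => if i.val + j.val + 1 = 2 then (1 : L) else 0)).Local v × (UnitaryGroup.cmDatum L 1 (Matrix.of fun i j : Fin 1 => if i.val + j.val + 1 = 1 then (1 : L) else 0)).Local v)] [BorelSpace ((UnitaryGroup.cmDatum L 2 (Matrix.of fun i j : Fin 2 => if i.val + j.val + 1 = 2 then (1 : L) else 0)).Local v × (UnitaryGroup.cmDatum L 1 (Matrix.of fun i j : Fin 1 => if i.val + j.val + 1 = 1 then (1 : L) else 0)).Local v)]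
    [∀ γ' : Gqs L v, MeasurableSpace (Gqs L v ⧸ Subgroup.centralizer ({γ'} : Set (Gqs L v)))]
    [∀ a : ((UnitaryGroup.cmDatum L 2 (Matrix.of fun i j : Fin 2 => if i.val + j.val + 1 = 2 then (1 : L) else 0)).Local v × (UnitaryGroup.cmDatum L 1 (Matrix.of fun i j : Fin 1 => if i.val + j.val + 1 = 1 then (1 : L) else 0)).Local v), MeasurableSpace (((UnitaryGroup.cmDatum L 2 (Matrix.of fun i j : Fin 2 => if i.val + j.val + 1 = 2 then (1 : L) else 0)).Local v × (UnitaryGroup.cmDatum L 1 (Matrix.of fun i j : Fin 1 => if i.val + j.val + 1 = 1 then (1 : L) else 0)).Local v) ⧸ Subgroup.centralizer ({a} : Set ((UnitaryGroup.cmDatum L 2 (Matrix.of fun i j : Fin 2 => if i.val + j.val + 1 = 2 then (1 : L) else 0)).Local v × (UnitaryGroup.cmDatum L 1 (Matrix.of fun i j : Fin 1 => if i.val + j.val + 1 = 1 then (1 : L) else 0)).Local v)))]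
    (μ : HeckeCharacter L)
    -- the closed forms, abstract (★ (A1′)-E letters; `dG` is only used as a class function — no non-vanishing is read)
    (dG : Gqs L v → ℝ) (hdG : ∀ h g : Gqs L v, dG (h * g * h⁻¹) = dG g)
    (dH : ((UnitaryGroup.cmDatum L 2 (Matrix.of fun i j : Fin 2 => if i.val + j.val + 1 = 2 then (1 : L) else 0)).Local v × (UnitaryGroup.cmDatum L 1 (Matrix.of fun i j : Fin 1 => if i.val + j.val + 1 = 1 then (1 : L) else 0)).Local v) → ℝ) (hDHst : ∀ a b, IsLocalGRegular L v a → IsLocalStablyConjH L v a b → dH b = dH a)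
    -- the compact `H`-Cartan system with embeddings and torus measures (★ (A1′)-E ∕ (E8) letters)
    (SH : Finset (Subgroup ((UnitaryGroup.cmDatum L 2 (Matrix.of fun i j : Fin 2 => if i.val + j.val + 1 = 2 then (1 : L) else 0)).Local v × (UnitaryGroup.cmDatum L 1 (Matrix.of fun i j : Fin 1 => if i.val + j.val + 1 = 1 then (1 : L) else 0)).Local v))) (n : Subgroup ((UnitaryGroup.cmDatum L 2 (Matrix.of fun i j : Fin 2 => if i.val + j.val + 1 = 2 then (1 : L) else 0)).Local v × (UnitaryGroup.cmDatum L 1 (Matrix.of fun i j : Fin 1 => if i.val + j.val + 1 = 1 then (1 : L) else 0)).Local v) → ℕ)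
    (γc : (T : Subgroup ((UnitaryGroup.cmDatum L 2 (Matrix.of fun i j : Fin 2 => if i.val + j.val + 1 = 2 then (1 : L) else 0)).Local v × (UnitaryGroup.cmDatum L 1 (Matrix.of fun i j : Fin 1 => if i.val + j.val + 1 = 1 then (1 : L) else 0)).Local v)) → Fin (n T) → Gqs L v)
    (eT : (T : Subgroup ((UnitaryGroup.cmDatum L 2 (Matrix.of fun i j : Fin 2 => if i.val + j.val + 1 = 2 then (1 : L) else 0)).Local v × (UnitaryGroup.cmDatum L 1 (Matrix.of fun i j : Fin 1 => if i.val + j.val + 1 = 1 then (1 : L) else 0)).Local v)) → (i : Fin (n T)) → (↥T ≃ₜ* ↥(Subgroup.centralizer ({γc T i} : Set (Gqs L v)))))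
    (heT : ∀ T ∈ SH, ∀ (i : Fin (n T)) (s : ↥T), IsLocalNormPair L (qsForm L) v s.1 ((eT T i s : ↥(Subgroup.centralizer ({γc T i} : Set (Gqs L v)))) : Gqs L v))
    (tH : (T : Subgroup ((UnitaryGroup.cmDatum L 2 (Matrix.of fun i j : Fin 2 => if i.val + j.val + 1 = 2 then (1 : L) else 0)).Local v × (UnitaryGroup.cmDatum L 1 (Matrix.of fun i j : Fin 1 => if i.val + j.val + 1 = 1 then (1 : L) else 0)).Local v)) → Measure ↥T)
    (hZ : ∀ T ∈ SH, ∃ γ₀ : ((UnitaryGroup.cmDatum L 2 (Matrix.of fun i j : Fin 2 => if i.val + j.val + 1 = 2 then (1 : L) else 0)).Local v × (UnitaryGroup.cmDatum L 1 (Matrix.of fun i j : Fin 1 => if i.val + j.val + 1 = 1 then (1 : L) else 0)).Local v), IsLocalGRegular L v γ₀ ∧ T = Subgroup.centralizer ({γ₀} : Set ((UnitaryGroup.cmDatum L 2 (Matrix.of fun i j : Fin 2 => if i.val + j.val + 1 = 2 then (1 : L) else 0)).Local v × (UnitaryGroup.cmDatum L 1 (Matrix.of fun i j : Fin 1 =>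 if i.val + j.val + 1 = 1 then (1 : L) else 0)).Local v)))
    (hKH : ∀ T ∈ SH, IsCompact (T : Set ((UnitaryGroup.cmDatum L 2 (Matrix.of fun i j : Fin 2 => if i.val + j.val + 1 = 2 then (1 : L) else 0)).Local v × (UnitaryGroup.cmDatum L 1 (Matrix.of fun i j : Fin 1 => if i.val + j.val + 1 = 1 then (1 : L) else 0)).Local v)))
    -- (H6a′) class counts, BY SHAPE
    (m : Subgroup ((UnitaryGroup.cmDatum L 2 (Matrix.of fun i j : Fin 2 => if i.val + j.val + 1 = 2 then (1 : L) else 0)).Local v × (UnitaryGroup.cmDatum L 1 (Matrix.of fun i j : Fin 1 => if i.val + j.val + 1 = 1 then (1 : L) else 0)).Local v) → ℕ)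
    (hclasses : ∀ T ∈ SH, ∀ s ∈ T, IsLocalGRegular L v s →
      ∃ C : Finset ((UnitaryGroup.cmDatum L 2 (Matrix.of fun i j : Fin 2 => if i.val + j.val + 1 = 2 then (1 : L) else 0)).Local v × (UnitaryGroup.cmDatum L 1 (Matrix.of fun i j : Fin 1 => if i.val + j.val + 1 = 1 then (1 : L) else 0)).Local v), (∀ x ∈ C, IsLocalStablyConjH L v s x) ∧ (∀ x ∈ C, ∀ y ∈ C, IsConj x y → x = y) ∧ (∀ y, IsLocalStablyConjH L v s y → ∃ x ∈ C, IsConj y x) ∧ C.card = m T)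
    -- the `G`-side elliptic Cartan system (data only; its properties are (E0)'s inputs)
    (Sell : Finset (Subgroup (Gqs L v))) (μTf : (T' : Subgroup (Gqs L v)) → Measure ↥T')
    -- (E2) FIBRE-ENUM ∕ (E2b) SLOT-AUT
    (cQ : Subgroup ((UnitaryGroup.cmDatum L 2 (Matrix.of fun i j : Fin 2 => if i.val + j.val + 1 = 2 then (1 : L) else 0)).Local v × (UnitaryGroup.cmDatum L 1 (Matrix.of fun i j : Fin 1 => if i.val + j.val + 1 = 1 then (1 : L) else 0)).Local v) → ℕ) (σ : (T : Subgroup ((UnitaryGroup.cmDatum L 2 (Matrix.of fun i j : Fin 2 => if i.val + j.val + 1 = 2 then (1 : L) else 0)).Local v × (UnitaryGroup.cmDatum L 1 (Matrix.of fun i j : Fin 1 => if i.val + j.val + 1 = 1 then (1 : L) else 0)).Local v)) → Fin (cQ T) → (↥T → ↥T))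
    (hσm : ∀ T ∈ SH, ∀ u : Fin (cQ T), MeasurePreserving (σ T u) (tH T) (tH T))
    (hσreg : ∀ T ∈ SH, ∀ (u : Fin (cQ T)) (s : ↥T), IsLocalGRegular L v (s : ((UnitaryGroup.cmDatum L 2 (Matrix.of fun i j : Fin 2 => if i.val + j.val + 1 = 2 then (1 : L) else 0)).Local v × (UnitaryGroup.cmDatum L 1 (Matrix.of fun i j : Fin 1 => if i.val + j.val + 1 = 1 then (1 : L) else 0)).Local v)) → IsLocalGRegular L v (σ T u s : ((UnitaryGroup.cmDatum L 2 (Matrix.of fun i j : Fin 2 => if i.val + j.val + 1 = 2 then (1 : L) else 0)).Local v × (UnitaryGroup.cmDatum L 1 (Matrix.of fun i j : Fin 1 => if i.val + j.val + 1 = 1 then (1 : L) else 0)).Local v)))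
    (hσR : ∀ T ∈ SH, ∀ (u : Fin (cQ T)) (i : Fin (n T)) (s : ↥T), IsLocalGRegular L v (s : ((UnitaryGroup.cmDatum L 2 (Matrix.of fun i j : Fin 2 => if i.val + j.val + 1 = 2 then (1 : L) else 0)).Local v × (UnitaryGroup.cmDatum L 1 (Matrix.of fun i j : Fin 1 => if i.val + j.val + 1 = 1 then (1 : L) else 0)).Local v)) → IsLocalNormPair L (qsForm L) v (σ T u s).1 ((eT T i s : ↥(Subgroup.centralizer ({γc T i} : Set (Gqs L v)))) : Gqs L v))
    (hσpair : ∀ T ∈ SH, ∀ (s : ↥T), IsLocalGRegular L v (s : ((UnitaryGroup.cmDatum L 2 (Matrix.of fun i j : Fin 2 => if i.val + j.val + 1 = 2 then (1 : L) else 0)).Local v × (UnitaryGroup.cmDatum L 1 (Matrix.of fun i j : Fin 1 => if i.val + j.val + 1 = 1 then (1 : L) else 0)).Local v)) → ∀ u u' : Fin (cQ T), u ≠ u' → ¬ IsLocalStablyConjH L v (σ T u s).1 (σ T u' s).1)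
    (hσexh : ∀ T ∈ SH, ∀ (i : Fin (n T)) (s : ↥T), IsLocalGRegular L v (s : ((UnitaryGroup.cmDatum L 2 (Matrix.of fun i j : Fin 2 => if i.val + j.val + 1 = 2 then (1 : L) else 0)).Local v × (UnitaryGroup.cmDatum L 1 (Matrix.of fun i j : Fin 1 => if i.val + j.val + 1 = 1 then (1 : L) else 0)).Local v)) → ∀ a : ((UnitaryGroup.cmDatum L 2 (Matrix.of fun i j : Fin 2 => if i.val + j.val + 1 = 2 then (1 : L) else 0)).Local v × (UnitaryGroup.cmDatum L 1 (Matrix.of fun i j : Fin 1 => if i.val + j.val + 1 = 1 then (1 : L) else 0)).Local v), IsLocalGRegular L v a → IsLocalNormPair L (qsForm L) v a ((eT T i s : ↥(Subgroup.centralizer ({γc T i} : Set (Gqs L v)))) : Gqs L v) →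
      ∃ u : Fin (cQ T), IsLocalStablyConjH L v a (σ T u s).1)
    -- (E6) INDEX TWO (Lemma 3.6.1) — read only for `n T ≠ 0`
    (hnm : ∀ T ∈ SH, n T = 2 * m T)
    -- (E7) the `G`-singular part of each compact `H`-Cartan is null
    (hsingH : ∀ T ∈ SH, tH T {s : ↥T | ¬ IsLocalGRegular L v (s : ((UnitaryGroup.cmDatum L 2 (Matrix.of fun i j : Fin 2 => if i.val + j.val + 1 = 2 then (1 : L) else 0)).Local v × (UnitaryGroup.cmDatum L 1 (Matrix.of fun i j : Fin 1 => if i.val + j.val + 1 = 1 then (1 : L) else 0)).Local v))} = 0)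
    -- (E0) G-REGROUP (its conclusion, for every admissible `Φ`, at these letters) and its transport companion
    (hE0 : ∀ Φ : Gqs L v → ℂ, (∀ x y : Gqs L v, IsConj x y → Φ x = Φ y) →
      (∀ x : Gqs L v, (¬ ∃ q : ((UnitaryGroup.cmDatum L 2 (Matrix.of fun i j : Fin 2 => if i.val + j.val + 1 = 2 then (1 : L) else 0)).Local v × (UnitaryGroup.cmDatum L 1 (Matrix.of fun i j : Fin 1 => if i.val + j.val + 1 = 1 then (1 : L) else 0)).Local v), IsLocalGRegular L v q ∧ IsLocalNormPair L (qsForm L) v q x) → Φ x = 0) →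
      (∀ T' ∈ Sell, Integrable (fun t : ↥T' => Φ (t : Gqs L v)) (μTf T')) →
      ∑ T' ∈ Sell, (((T'.subgroupOf (Subgroup.normalizer (T' : Set (Gqs L v)))).index : ℂ))⁻¹ * ∫ t : ↥T', Φ (t : Gqs L v) ∂(μTf T') =
        ∑ T ∈ SH, ((((T.subgroupOf (Subgroup.normalizer (T : Set ((UnitaryGroup.cmDatum L 2 (Matrix.of fun i j : Fin 2 => if i.val + j.val + 1 = 2 then (1 : L) else 0)).Local v × (UnitaryGroup.cmDatum L 1 (Matrix.of fun i j : Fin 1 => if i.val + j.val + 1 = 1 then (1 : L) else 0)).Local v)))).index : ℂ))⁻¹ * ((m T : ℂ))⁻¹ * ((cQ T : ℂ))⁻¹) *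
          ∑ i : Fin (n T), ∫ s in {s : ↥T | IsLocalGRegular L v (s : ((UnitaryGroup.cmDatum L 2 (Matrix.of fun i j : Fin 2 => if i.val + j.val + 1 = 2 then (1 : L) else 0)).Local v × (UnitaryGroup.cmDatum L 1 (Matrix.of fun i j : Fin 1 => if i.val + j.val + 1 = 1 then (1 : L) else 0)).Local v))}, Φ ((eT T i s : ↥(Subgroup.centralizer ({γc T i} : Set (Gqs L v)))) : Gqs L v) ∂(tH T))
    (hE0i : ∀ Φ : Gqs L v → ℂ, (∀ x y : Gqs L v, IsConj x y → Φ x = Φ y) →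
      (∀ x : Gqs L v, (¬ ∃ q : ((UnitaryGroup.cmDatum L 2 (Matrix.of fun i j : Fin 2 => if i.val + j.val + 1 = 2 then (1 : L) else 0)).Local v × (UnitaryGroup.cmDatum L 1 (Matrix.of fun i j : Fin 1 => if i.val + j.val + 1 = 1 then (1 : L) else 0)).Local v), IsLocalGRegular L v q ∧ IsLocalNormPair L (qsForm L) v q x) → Φ x = 0) →
      (∀ T' ∈ Sell, Integrable (fun t : ↥T' => Φ (t : Gqs L v)) (μTf T')) →
      ∀ T ∈ SH, ∀ i : Fin (n T), IntegrableOn (fun s : ↥T => Φ ((eT T i s : ↥(Subgroup.centralizer ({γc T i} : Set (Gqs L v)))) : Gqs L v)) {s : ↥T | IsLocalGRegular L v (s : ((UnitaryGroup.cmDatum L 2 (Matrix.of fun i j : Fin 2 => if i.val + j.val + 1 = 2 then (1 : L) else 0)).Local v × (UnitaryGroup.cmDatum L 1 (Matrix.of fun i j : Fin 1 => if i.val + j.val + 1 = 1 then (1 : L) else 0)).Local v))} (tH T))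
    -- the analytic data: orbital measure families, the test functions, the stable class function
    (mQv : OrbitalMeasureFamily (Gqs L v)) (f : Gqs L v → ℂ)
    (mHv : OrbitalMeasureFamily ((UnitaryGroup.cmDatum L 2 (Matrix.of fun i j : Fin 2 => if i.val + j.val + 1 = 2 then (1 : L) else 0)).Local v × (UnitaryGroup.cmDatum L 1 (Matrix.of fun i j : Fin 1 => if i.val + j.val + 1 = 1 then (1 : L) else 0)).Local v)) (fH : ((UnitaryGroup.cmDatum L 2 (Matrix.of fun i j : Fin 2 => if i.val + j.val + 1 = 2 then (1 : L) else 0)).Local v × (UnitaryGroup.cmDatum L 1 (Matrix.of fun i j : Fin 1 => if i.val + j.val + 1 = 1 then (1 : L) else 0)).Local v) → ℂ)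
    (α : ((UnitaryGroup.cmDatum L 2 (Matrix.of fun i j : Fin 2 => if i.val + j.val + 1 = 2 then (1 : L) else 0)).Local v × (UnitaryGroup.cmDatum L 1 (Matrix.of fun i j : Fin 1 => if i.val + j.val + 1 = 1 then (1 : L) else 0)).Local v) → ℂ)
    (hαst : Ch12Sec5.IsStableClassFunOn (IsLocalStablyConjH L v) {a : ((UnitaryGroup.cmDatum L 2 (Matrix.of fun i j : Fin 2 => if i.val + j.val + 1 = 2 then (1 : L) else 0)).Local v × (UnitaryGroup.cmDatum L 1 (Matrix.of fun i j : Fin 1 => if i.val + j.val + 1 = 1 then (1 : L) else 0)).Local v) | IsLocalGRegular L v a ∧ IsCompact ((Subgroup.centralizer ({a} : Set ((UnitaryGroup.cmDatum L 2 (Matrix.of fun i j : Fin 2 => if i.val + j.val + 1 = 2 then (1 : L) else 0)).Local v × (UnitaryGroup.cmDatum L 1 (Matrix.of fun i j : Fin 1 => if i.val + j.val + 1 = 1 then (1 : L) else 0)).Local v)) : Subgroup ((UnitaryGroup.cmDatum L 2 (Matrix.of fun i j : Fin 2 => if i.val + j.val + 1 = 2 then (1 : L) else 0)).Local v × (UnitaryGroup.cmDatum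 L 1 (Matrix.of fun i j : Fin 1 => if i.val + j.val + 1 = 1 then (1 : L) else 0)).Local v)) : Set ((UnitaryGroup.cmDatum L 2 (Matrix.of fun i j : Fin 2 => if i.val + j.val + 1 = 2 then (1 : L) else 0)).Local v × (UnitaryGroup.cmDatum L 1 (Matrix.of fun i j : Fin 1 => if i.val + j.val + 1 = 1 then (1 : L) else 0)).Local v))} α)
    -- (P2σ): ★ (P2) AT EACH SLOT `σ_u s`, on the embedding transversal `{e_i s}_i` (BY SHAPE)
    (hP2σ : ∀ T ∈ SH, ∀ (u : Fin (cQ T)) (s : ↥T), IsLocalGRegular L v (s : ((UnitaryGroup.cmDatum L 2 (Matrix.of fun i j : Fin 2 => if i.val + j.val + 1 = 2 then (1 : L) else 0)).Local v × (UnitaryGroup.cmDatum L 1 (Matrix.of fun i j : Fin 1 => if i.val + j.val + 1 = 1 then (1 : L) else 0)).Local v)) →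
      ∑ i : Fin (n T), (dG ((eT T i s : ↥(Subgroup.centralizer ({γc T i} : Set (Gqs L v)))) : Gqs L v) : ℂ) *
          (finTau L v (σ T u s).1 μ * (dH (σ T u s).1 : ℂ) * ((finKappaAt L v (qsForm L) (σ T u s).1 ((eT T i s : ↥(Subgroup.centralizer ({γc T i} : Set (Gqs L v)))) : Gqs L v) : ℤ) : ℂ) * α (σ T u s).1) *
          classOrbitalIntegral mQv f (ConjClasses.mk ((eT T i s : ↥(Subgroup.centralizer ({γc T i} : Set (Gqs L v)))) : Gqs L v)) =
        ((dH (σ T u s).1 : ℂ)) ^ 2 * α (σ T u s).1 * stableOrbitalIntegralRel (IsLocalStablyConjH L v) mHv fH (σ T u s).1)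
    -- the two GIVEN totals
    (hIG : ∀ T' ∈ Sell, Integrable (fun t : ↥T' => ((dG (t : Gqs L v) : ℂ)) ^ 2 *
      (if IsRegularElt (((t : Gqs L v)).val : GL (Fin 3) (UnitaryGroup.LocalRing L v)) then ((dG (t : Gqs L v) : ℂ))⁻¹ * ∑ᶠ q : Quot (IsLocalStablyConjH L v), (if IsLocalGRegular L v q.out ∧ IsLocalNormPair L (qsForm L) v q.out (t : Gqs L v) then finTau L v q.out μ * (dH q.out : ℂ) * ((finKappaAt L v (qsForm L) q.out (t : Gqs L v) : ℤ) : ℂ) * α q.out else 0) else 0) *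
      classOrbitalIntegral mQv f (ConjClasses.mk (t : Gqs L v))) (μTf T'))
    (hIH : ∀ T ∈ SH, Integrable (fun s : ↥T => ((dH (s : ((UnitaryGroup.cmDatum L 2 (Matrix.of fun i j : Fin 2 => if i.val + j.val + 1 = 2 then (1 : L) else 0)).Local v × (UnitaryGroup.cmDatum L 1 (Matrix.of fun i j : Fin 1 => if i.val + j.val + 1 = 1 then (1 : L) else 0)).Local v)) : ℂ)) ^ 2 * α (s : ((UnitaryGroup.cmDatum L 2 (Matrix.of fun i j : Fin 2 => if i.val + j.val + 1 = 2 then (1 : L) else 0)).Local v × (UnitaryGroup.cmDatum L 1 (Matrix.of fun i j : Fin 1 => if i.val + j.val + 1 = 1 then (1 : L) else 0)).Local v)) * stableOrbitalIntegralRel (IsLocalStablyConjH L v) mHv fH (s : ((UnitaryGroup.cmDatum L 2 (Matrix.of fun i j : Fin 2 => if i.val + j.val + 1 = 2 then (1 : L) else 0)).Local v × (UnitaryGroup.cmDatum L 1 (Matrix.of fun i j : Fin 1 => if i.val + j.val + 1 = 1 then (1 : L) else 0)).Local v))) (tH T)) :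
    ∑ T' ∈ Sell, (((T'.subgroupOf (Subgroup.normalizer (T' : Set (Gqs L v)))).index : ℂ))⁻¹ * ∫ t : ↥T', ((dG (t : Gqs L v) : ℂ)) ^ 2 *
      (if IsRegularElt (((t : Gqs L v)).val : GL (Fin 3) (UnitaryGroup.LocalRing L v)) then ((dG (t : Gqs L v) : ℂ))⁻¹ * ∑ᶠ q : Quot (IsLocalStablyConjH L v), (if IsLocalGRegular L v q.out ∧ IsLocalNormPair L (qsForm L) v q.out (t : Gqs L v) then finTau L v q.out μ * (dH q.out : ℂ) * ((finKappaAt L v (qsForm L) q.out (t : Gqs L v) : ℤ) : ℂ) * α q.out else 0) else 0) *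
      classOrbitalIntegral mQv f (ConjClasses.mk (t : Gqs L v)) ∂(μTf T') =
      ∑ T ∈ SH, ((((T.subgroupOf (Subgroup.normalizer (T : Set ((UnitaryGroup.cmDatum L 2 (Matrix.of fun i j : Fin 2 => if i.val + j.val + 1 = 2 then (1 : L) else 0)).Local v × (UnitaryGroup.cmDatum L 1 (Matrix.of fun i j : Fin 1 => if i.val + j.val + 1 = 1 then (1 : L) else 0)).Local v)))).index : ℂ))⁻¹ * ((m T : ℂ))⁻¹) *
        ∫ s : ↥T, ((dH (s : ((UnitaryGroup.cmDatum L 2 (Matrix.of fun i j : Fin 2 => if i.val + j.val + 1 = 2 then (1 : L) else 0)).Local v × (UnitaryGroup.cmDatum L 1 (Matrix.of fun i j : Fin 1 => if i.val + j.val + 1 = 1 then (1 : L) else 0)).Local v)) : ℂ)) ^ 2 * α (s : ((UnitaryGroup.cmDatum L 2 (Matrix.of fun i j : Fin 2 => if i.val + j.val + 1 = 2 then (1 : L) else 0)).Local v × (UnitaryGroup.cmDatum L 1 (Matrix.of fun i j : Fin 1 => if i.val + j.val + 1 = 1 then (1 : L) else 0)).Local v)) * stableOrbitalIntegralRel (IsLocalStablyConjH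 L v) mHv fH (s : ((UnitaryGroup.cmDatum L 2 (Matrix.of fun i j : Fin 2 => if i.val + j.val + 1 = 2 then (1 : L) else 0)).Local v × (UnitaryGroup.cmDatum L 1 (Matrix.of fun i j : Fin 1 => if i.val + j.val + 1 = 1 then (1 : L) else 0)).Local v)) ∂(tH T) := by
  -- ### the up-function and the torus integrand, named locally
  set up : Gqs L v → ℂ := fun x => (if IsRegularElt ((x).val : GL (Fin 3) (UnitaryGroup.LocalRing L v)) then ((dG x : ℂ))⁻¹ * ∑ᶠ q : Quot (IsLocalStablyConjH L v), (if IsLocalGRegular L v q.out ∧ IsLocalNormPair L (qsForm L) v q.out x then finTau L v q.out μ * (dH q.out : ℂ) * ((finKappaAt L v (qsForm L) q.out x : ℤ) : ℂ) * α q.out else 0) else 0) with hup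
  set Φ : Gqs L v → ℂ := fun x => ((dG x : ℂ)) ^ 2 * up x * classOrbitalIntegral mQv f (ConjClasses.mk x) with hΦ
  set F : ((UnitaryGroup.cmDatum L 2 (Matrix.of fun i j : Fin 2 => if i.val + j.val + 1 = 2 then (1 : L) else 0)).Local v × (UnitaryGroup.cmDatum L 1 (Matrix.of fun i j : Fin 1 => if i.val + j.val + 1 = 1 then (1 : L) else 0)).Local v) → ℂ := fun a => ((dH a : ℂ)) ^ 2 * α a * stableOrbitalIntegralRel (IsLocalStablyConjH L v) mHv fH a with hFdef
  show ∑ T' ∈ Sell, (((T'.subgroupOf (Subgroup.normalizer (T' : Set (Gqs L v)))).index : ℂ))⁻¹ * ∫ t : ↥T', Φ (t : Gqs L v) ∂(μTf T') =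
    ∑ T ∈ SH, ((((T.subgroupOf (Subgroup.normalizer (T : Set ((UnitaryGroup.cmDatum L 2 (Matrix.of fun i j : Fin 2 => if i.val + j.val + 1 = 2 then (1 : L) else 0)).Local v × (UnitaryGroup.cmDatum L 1 (Matrix.of fun i j : Fin 1 => if i.val + j.val + 1 = 1 then (1 : L) else 0)).Local v)))).index : ℂ))⁻¹ * ((m T : ℂ))⁻¹) * ∫ s : ↥T, F (s : ((UnitaryGroup.cmDatum L 2 (Matrix.of fun i j : Fin 2 => if i.val + j.val + 1 = 2 then (1 : L) else 0)).Local v × (UnitaryGroup.cmDatum L 1 (Matrix.of fun i j : Fin 1 => if i.val + j.val + 1 = 1 then (1 : L) else 0)).Local v)) ∂(tH T)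
  -- ### the relation letters
  have hst_symm : ∀ {a b : ((UnitaryGroup.cmDatum L 2 (Matrix.of fun i j : Fin 2 => if i.val + j.val + 1 = 2 then (1 : L) else 0)).Local v × (UnitaryGroup.cmDatum L 1 (Matrix.of fun i j : Fin 1 => if i.val + j.val + 1 = 1 then (1 : L) else 0)).Local v)}, IsLocalStablyConjH L v a b → IsLocalStablyConjH L v b a := fun h => h.symm
  have hst_trans : ∀ {a b c : ((UnitaryGroup.cmDatum L 2 (Matrix.of fun i j : Fin 2 => if i.val + j.val + 1 = 2 then (1 : L) else 0)).Local v × (UnitaryGroup.cmDatum L 1 (Matrix.of fun i j : Fin 1 => if i.val + j.val + 1 = 1 then (1 : L) else 0)).Local v)}, IsLocalStablyConjH L v a b → IsLocalStablyConjH L v b c → IsLocalStablyConjH L v a c := fun h h' => h.trans h'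
  -- ### (i) `up` is a class function on `G`, vanishing off the matched set; hence so is `Φ`
  have hupc : ∀ x c : Gqs L v, up (c * x * c⁻¹) = up x := by
    intro x c
    have hreg : IsRegularElt ((c * x * c⁻¹).val : GL (Fin 3) (UnitaryGroup.LocalRing L v)) ↔ IsRegularElt ((x).val : GL (Fin 3) (UnitaryGroup.LocalRing L v)) := isRegularElt_conj_val_iff L v c x
    show (if IsRegularElt (((c * x * c⁻¹)).val : GL (Fin 3) (UnitaryGroup.LocalRing L v)) then ((dG (c * x * c⁻¹) : ℂ))⁻¹ * ∑ᶠ q : Quot (IsLocalStablyConjH L v), (if IsLocalGRegular L v q.out ∧ IsLocalNormPair L (qsForm L) v q.out (c * x * c⁻¹) then finTau L v q.out μ * (dH q.out : ℂ) * ((finKappaAt L v (qsForm L) q.out (c * x * c⁻¹) : ℤ) : ℂ) * α q.out else 0) else 0) = (if IsRegularElt ((x).val : GL (Fin 3) (UnitaryGroup.LocalRing L v)) then ((dG x : ℂ))⁻¹ * ∑ᶠ q : Quot (IsLocalStablyConjH L v), (if IsLocalGRegular L v q.out ∧ IsLocalNormPair L (qsForm L) v q.out x then finTau L v q.out μ *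 (dH q.out : ℂ) * ((finKappaAt L v (qsForm L) q.out x : ℤ) : ℂ) * α q.out else 0) else 0)
    by_cases hx : IsRegularElt ((x).val : GL (Fin 3) (UnitaryGroup.LocalRing L v))
    · rw [if_pos (hreg.2 hx), if_pos hx, hdG]
      congr 1
      refine finsum_congr fun q => ?_
      by_cases hR : IsLocalNormPair L (qsForm L) v q.out x
      · have hR' : IsLocalNormPair L (qsForm L) v q.out (c * x * c⁻¹) :=
          F0P3cStCharTSUpTrClaimP.isLocalNormPair_of_isConj_right L v q.out (isConj_iff.2 ⟨c, rfl⟩) hR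
        simp only [hR, hR', and_true, finKappaAt_conj_right L v (qsForm L) q.out x c hR]
      · have hR' : ¬ IsLocalNormPair L (qsForm L) v q.out (c * x * c⁻¹) := fun h =>
          hR (F0P3cStCharTSUpTrClaimP.isLocalNormPair_of_isConj_right L v q.out (isConj_iff.2 ⟨c, rfl⟩ : IsConj x (c * x * c⁻¹)).symm h)
        simp only [hR, hR', and_false, if_false]
    · rw [if_neg (fun h => hx (hreg.1 h)), if_neg hx]
  have hΦc : ∀ x y : Gqs L v, IsConj x y → Φ x = Φ y := by
    intro x y hxy
    have hcl : ConjClasses.mk x = ConjClasses.mk y := ConjClasses.mk_eq_mk_iff_isConj.2 hxy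
    obtain ⟨c, rfl⟩ := isConj_iff.1 hxy
    show ((dG x : ℂ)) ^ 2 * up x * classOrbitalIntegral mQv f (ConjClasses.mk x) = ((dG (c * x * c⁻¹) : ℂ)) ^ 2 * up (c * x * c⁻¹) * classOrbitalIntegral mQv f (ConjClasses.mk (c * x * c⁻¹))
    rw [hupc, hdG, hcl]
  have hup0 : ∀ x : Gqs L v, (¬ ∃ q : ((UnitaryGroup.cmDatum L 2 (Matrix.of fun i j : Fin 2 => if i.val + j.val + 1 = 2 then (1 : L) else 0)).Local v × (UnitaryGroup.cmDatum L 1 (Matrix.of fun i j : Fin 1 => if i.val + j.val + 1 = 1 then (1 : L) else 0)).Local v), IsLocalGRegular L v q ∧ IsLocalNormPair L (qsForm L) v q x) → up x = 0 := by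
    intro x hx
    have h0 : (∑ᶠ q : Quot (IsLocalStablyConjH L v), (if IsLocalGRegular L v q.out ∧ IsLocalNormPair L (qsForm L) v q.out x then finTau L v q.out μ * (dH q.out : ℂ) * ((finKappaAt L v (qsForm L) q.out x : ℤ) : ℂ) * α q.out else 0)) = 0 :=
      finsum_eq_zero_of_forall_eq_zero fun q => if_neg fun hq => hx ⟨q.out, hq⟩
    show (if IsRegularElt ((x).val : GL (Fin 3) (UnitaryGroup.LocalRing L v)) then ((dG x : ℂ))⁻¹ * ∑ᶠ q : Quot (IsLocalStablyConjH L v), (if IsLocalGRegular L v q.out ∧ IsLocalNormPair L (qsForm L) v q.out x then finTau L v q.out μ * (dH q.out : ℂ) * ((finKappaAt L v (qsForm L) q.out x : ℤ) : ℂ) * α q.out else 0) else 0) = 0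
    rw [h0, mul_zero, ite_self]
  have hΦ0 : ∀ x : Gqs L v, (¬ ∃ q : ((UnitaryGroup.cmDatum L 2 (Matrix.of fun i j : Fin 2 => if i.val + j.val + 1 = 2 then (1 : L) else 0)).Local v × (UnitaryGroup.cmDatum L 1 (Matrix.of fun i j : Fin 1 => if i.val + j.val + 1 = 1 then (1 : L) else 0)).Local v), IsLocalGRegular L v q ∧ IsLocalNormPair L (qsForm L) v q x) → Φ x = 0 := by
    intro x hx
    show ((dG x : ℂ)) ^ 2 * up x * classOrbitalIntegral mQv f (ConjClasses.mk x) = 0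
    rw [hup0 x hx, mul_zero, zero_mul]
  -- ### (ii) (E0): regroup the `G`-side over the `H`-Cartan system
  rw [hE0 Φ hΦc hΦ0 hIG]
  refine Finset.sum_congr rfl fun T hT => ?_
  -- ### (iii) per member `T ∈ SH`
  obtain ⟨γ₀, hγ₀, hTeq⟩ := hZ T hT
  have hγ₀T : γ₀ ∈ T := by rw [hTeq]; exact Subgroup.mem_centralizer_singleton_iff.2 rfl
  have hm0 : m T ≠ 0 := by
    obtain ⟨C, -, -, hCexh, hCcard⟩ := hclasses T hT γ₀ hγ₀T hγ₀
    obtain ⟨x, hx, -⟩ := hCexh γ₀ (IsStablyConjH.refl _ _ _ γ₀)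
    rw [← hCcard]
    exact Finset.card_ne_zero.2 ⟨x, hx⟩
  have hn0 : n T ≠ 0 := by rw [hnm T hT]; omega
  have hc0 : cQ T ≠ 0 := by
    obtain ⟨i₀⟩ : Nonempty (Fin (n T)) := ⟨⟨0, Nat.pos_of_ne_zero hn0⟩⟩
    obtain ⟨u, -⟩ := hσexh T hT i₀ ⟨γ₀, hγ₀T⟩ hγ₀ γ₀ hγ₀ (heT T hT i₀ ⟨γ₀, hγ₀T⟩)
    exact Fin.pos_iff_nonempty.2 ⟨u⟩ |>.ne'
  -- the `G`-regular set of `T` has full `tH T`-measure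
  have hae : ∀ᵐ s ∂(tH T), IsLocalGRegular L v ((s : ↥T) : ((UnitaryGroup.cmDatum L 2 (Matrix.of fun i j : Fin 2 => if i.val + j.val + 1 = 2 then (1 : L) else 0)).Local v × (UnitaryGroup.cmDatum L 1 (Matrix.of fun i j : Fin 1 => if i.val + j.val + 1 = 1 then (1 : L) else 0)).Local v)) := by
    have h := (measure_eq_zero_iff_ae_notMem (μ := tH T)).1 (hsingH T hT)
    filter_upwards [h] with s hs
    simpa using hs
  have hres : (tH T).restrict {s : ↥T | IsLocalGRegular L v (s : ((UnitaryGroup.cmDatum L 2 (Matrix.of fun i j : Fin 2 => if i.val + j.val + 1 = 2 then (1 : L) else 0)).Local v × (UnitaryGroup.cmDatum L 1 (Matrix.of fun i j : Fin 1 => if i.val + j.val + 1 = 1 then (1 : L) else 0)).Local v))} = tH T := Measure.restrict_eq_self_of_ae_mem hae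
  simp_rw [hres]
  -- integrability of the transported `G`-torus integrand (a CONCLUSION of (E0), fence (γ)) and of the `H`-side total
  have hint : ∀ i : Fin (n T), Integrable (fun s : ↥T => Φ ((eT T i s : ↥(Subgroup.centralizer ({γc T i} : Set (Gqs L v)))) : Gqs L v)) (tH T) := by
    intro i
    have h := hE0i Φ hΦc hΦ0 hIG T hT i
    rwa [IntegrableOn, hres] at h
  have hFint : Integrable (fun s : ↥T => F (s : ((UnitaryGroup.cmDatum L 2 (Matrix.of fun i j : Fin 2 => if i.val + j.val + 1 = 2 then (1 : L) else 0)).Local v × (UnitaryGroup.cmDatum L 1 (Matrix.of fun i j : Fin 1 => if i.val + j.val + 1 = 1 then (1 : L) else 0)).Local v))) (tH T) := hIH T hT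
  -- ### (iv) the pointwise identity at a `G`-regular `s ∈ T`: `Σ_i Φ(e_i s) = Σ_u F(σ_u s)`
  have hpt : ∀ s : ↥T, IsLocalGRegular L v (s : ((UnitaryGroup.cmDatum L 2 (Matrix.of fun i j : Fin 2 => if i.val + j.val + 1 = 2 then (1 : L) else 0)).Local v × (UnitaryGroup.cmDatum L 1 (Matrix.of fun i j : Fin 1 => if i.val + j.val + 1 = 1 then (1 : L) else 0)).Local v)) →
      ∑ i : Fin (n T), Φ ((eT T i s : ↥(Subgroup.centralizer ({γc T i} : Set (Gqs L v)))) : Gqs L v) = ∑ u : Fin (cQ T), F ((σ T u s) : ((UnitaryGroup.cmDatum L 2 (Matrix.of fun i j : Fin 2 => if i.val + j.val + 1 = 2 then (1 : L) else 0)).Local v × (UnitaryGroup.cmDatum L 1 (Matrix.of fun i j : Fin 1 => if i.val + j.val + 1 = 1 then (1 : L) else 0)).Local v)) := by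
    intro s hs
    -- the slots are `G`-regular points of the compact Cartan `T`: `α` is constant on their stable classes
    have hgood : ∀ u : Fin (cQ T), ((σ T u s) : ((UnitaryGroup.cmDatum L 2 (Matrix.of fun i j : Fin 2 => if i.val + j.val + 1 = 2 then (1 : L) else 0)).Local v × (UnitaryGroup.cmDatum L 1 (Matrix.of fun i j : Fin 1 => if i.val + j.val + 1 = 1 then (1 : L) else 0)).Local v)) ∈ {a : ((UnitaryGroup.cmDatum L 2 (Matrix.of fun i j : Fin 2 => if i.val + j.val + 1 = 2 then (1 : L) else 0)).Local v × (UnitaryGroup.cmDatum L 1 (Matrix.of fun i j : Fin 1 => if i.val + j.val + 1 = 1 then (1 : L) else 0)).Local v) | IsLocalGRegular L v a ∧ IsCompact ((Subgroup.centralizer ({a} : Set ((UnitaryGroup.cmDatum L 2 (Matrix.of fun i j : Fin 2 => if i.val + j.val + 1 = 2 then (1 : L) else 0)).Local v × (UnitaryGroup.cmDatum L 1 (Matrix.of fun i j : Fin 1 => if i.val + j.val + 1 = 1 then (1 : L) else 0)).Local v)) : Subgroup ((UnitaryGroup.cmDatum L 2 (Matrix.of fun i j : Fin 2 => if i.val +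 j.val + 1 = 2 then (1 : L) else 0)).Local v × (UnitaryGroup.cmDatum L 1 (Matrix.of fun i j : Fin 1 => if i.val + j.val + 1 = 1 then (1 : L) else 0)).Local v)) : Set ((UnitaryGroup.cmDatum L 2 (Matrix.of fun i j : Fin 2 => if i.val + j.val + 1 = 2 then (1 : L) else 0)).Local v × (UnitaryGroup.cmDatum L 1 (Matrix.of fun i j : Fin 1 => if i.val + j.val + 1 = 1 then (1 : L) else 0)).Local v))} := by
      intro u
      refine ⟨hσreg T hT u s hs, ?_⟩
      rw [F0P3cStCharTSUpTrCartanFields.centralizer_eq_cartan_of_isLocalGRegular hγ₀ hTeq (σ T u s) (hσreg T hT u s hs)]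
      exact hKH T hT
    have hinjσ : Function.Injective (fun u : Fin (cQ T) => ((σ T u s) : ((UnitaryGroup.cmDatum L 2 (Matrix.of fun i j : Fin 2 => if i.val + j.val + 1 = 2 then (1 : L) else 0)).Local v × (UnitaryGroup.cmDatum L 1 (Matrix.of fun i j : Fin 1 => if i.val + j.val + 1 = 1 then (1 : L) else 0)).Local v))) := by
      intro u u' h
      dsimp only at h
      by_contra hne
      exact hσpair T hT s hs u u' hne (by rw [h]; exact IsStablyConjH.refl _ _ _ _)
    have hxreg : ∀ i : Fin (n T), IsRegularElt ((((eT T i s : ↥(Subgroup.centralizer ({γc T i} : Set (Gqs L v)))) : Gqs L v)).val : GL (Fin 3) (UnitaryGroup.LocalRing L v)) := fun i =>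
      (isLocalGRegular_iff_isRegularElt_of_isLocalNormPair L v (heT T hT i s)).1 hs
    -- per embedding `i`: UP-EVAL on the slot transversal
    have hupi : ∀ i : Fin (n T), up ((eT T i s : ↥(Subgroup.centralizer ({γc T i} : Set (Gqs L v)))) : Gqs L v) =
        ((dG ((eT T i s : ↥(Subgroup.centralizer ({γc T i} : Set (Gqs L v)))) : Gqs L v) : ℂ))⁻¹ * ∑ u : Fin (cQ T), finTau L v ((σ T u s) : ((UnitaryGroup.cmDatum L 2 (Matrix.of fun i j : Fin 2 => if i.val + j.val + 1 = 2 then (1 : L) else 0)).Local v × (UnitaryGroup.cmDatum L 1 (Matrix.of fun i j : Fin 1 => if i.val + j.val + 1 = 1 then (1 : L) else 0)).Local v)) μ * (dH ((σ T u s) : ((UnitaryGroup.cmDatum L 2 (Matrix.of fun i j : Fin 2 => if i.val + j.val + 1 = 2 then (1 : L) else 0)).Local v × (UnitaryGroup.cmDatum L 1 (Matrix.of fun i j : Fin 1 => if i.val + j.val + 1 = 1 then (1 : L) else 0)).Local v)) : ℂ) * ((finKappaAt L v (qsForm L) ((σ T u s) : ((UnitaryGroup.cmDatum L 2 (Matrix.of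 fun i j : Fin 2 => if i.val + j.val + 1 = 2 then (1 : L) else 0)).Local v × (UnitaryGroup.cmDatum L 1 (Matrix.of fun i j : Fin 1 => if i.val + j.val + 1 = 1 then (1 : L) else 0)).Local v)) ((eT T i s : ↥(Subgroup.centralizer ({γc T i} : Set (Gqs L v)))) : Gqs L v) : ℤ) : ℂ) * α ((σ T u s) : ((UnitaryGroup.cmDatum L 2 (Matrix.of fun i j : Fin 2 => if i.val + j.val + 1 = 2 then (1 : L) else 0)).Local v × (UnitaryGroup.cmDatum L 1 (Matrix.of fun i j : Fin 1 => if i.val + j.val + 1 = 1 then (1 : L) else 0)).Local v)) := by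
      intro i
      show (if IsRegularElt ((((eT T i s : ↥(Subgroup.centralizer ({γc T i} : Set (Gqs L v)))) : Gqs L v)).val : GL (Fin 3) (UnitaryGroup.LocalRing L v)) then ((dG ((eT T i s : ↥(Subgroup.centralizer ({γc T i} : Set (Gqs L v)))) : Gqs L v) : ℂ))⁻¹ * ∑ᶠ q : Quot (IsLocalStablyConjH L v), (if IsLocalGRegular L v q.out ∧ IsLocalNormPair L (qsForm L) v q.out ((eT T i s : ↥(Subgroup.centralizer ({γc T i} : Set (Gqs L v)))) : Gqs L v) then finTau L v q.out μ * (dH q.out : ℂ) * ((finKappaAt L v (qsForm L) q.out ((eT T i s : ↥(Subgroup.centralizer ({γc T i} : Set (Gqs L v)))) : Gqs L v) : ℤ) : ℂ) * α q.out else 0) else 0) = _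
      rw [if_pos (hxreg i)]
      congr 1
      have key := finsum_quot_eq_sum L v ((eT T i s : ↥(Subgroup.centralizer ({γc T i} : Set (Gqs L v)))) : Gqs L v)
        (fun a => if IsLocalGRegular L v a ∧ IsLocalNormPair L (qsForm L) v a ((eT T i s : ↥(Subgroup.centralizer ({γc T i} : Set (Gqs L v)))) : Gqs L v) then finTau L v a μ * (dH a : ℂ) * ((finKappaAt L v (qsForm L) a ((eT T i s : ↥(Subgroup.centralizer ({γc T i} : Set (Gqs L v)))) : Gqs L v) : ℤ) : ℂ) * α a else 0)
        (fun a b ha hab => ?_)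
        ((Finset.univ : Finset (Fin (cQ T))).image (fun u : Fin (cQ T) => ((σ T u s) : ((UnitaryGroup.cmDatum L 2 (Matrix.of fun i j : Fin 2 => if i.val + j.val + 1 = 2 then (1 : L) else 0)).Local v × (UnitaryGroup.cmDatum L 1 (Matrix.of fun i j : Fin 1 => if i.val + j.val + 1 = 1 then (1 : L) else 0)).Local v))))
        (fun t ht => ?_) (fun t ht t' ht' hne => ?_) (fun a ha hR => ?_)
      · rw [Finset.sum_image (fun u _ u' _ h => hinjσ h)] at key
        refine (finsum_congr fun q => ?_).trans (key.trans (Finset.sum_congr rfl fun u _ => ?_))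
        · by_cases hq : IsLocalGRegular L v q.out ∧ IsLocalNormPair L (qsForm L) v q.out ((eT T i s : ↥(Subgroup.centralizer ({γc T i} : Set (Gqs L v)))) : Gqs L v)
          · simp only [hq, and_self, if_true]
          · simp only [hq, if_false]
        · rw [if_pos ⟨hσreg T hT u s hs, hσR T hT u i s hs⟩]
      · by_cases hc : IsLocalGRegular L v a ∧ IsLocalNormPair L (qsForm L) v a ((eT T i s : ↥(Subgroup.centralizer ({γc T i} : Set (Gqs L v)))) : Gqs L v)
        · have hb : IsLocalGRegular L v b ∧ IsLocalNormPair L (qsForm L) v b ((eT T i s : ↥(Subgroup.centralizer ({γc T i} : Set (Gqs L v)))) : Gqs L v) :=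
            ⟨isLocalGRegular_of_isLocalStablyConjH L v ha hab, (isLocalNormPair_iff_of_isLocalStablyConjH L v (qsForm L) hab _).2 hc.2⟩
          obtain ⟨u, hu⟩ := hσexh T hT i s hs a hc.1 hc.2
          have hαa : α a = α ((σ T u s) : ((UnitaryGroup.cmDatum L 2 (Matrix.of fun i j : Fin 2 => if i.val + j.val + 1 = 2 then (1 : L) else 0)).Local v × (UnitaryGroup.cmDatum L 1 (Matrix.of fun i j : Fin 1 => if i.val + j.val + 1 = 1 then (1 : L) else 0)).Local v)) := hαst.2 _ (hgood u) a (hst_symm hu)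
          have hαb : α b = α ((σ T u s) : ((UnitaryGroup.cmDatum L 2 (Matrix.of fun i j : Fin 2 => if i.val + j.val + 1 = 2 then (1 : L) else 0)).Local v × (UnitaryGroup.cmDatum L 1 (Matrix.of fun i j : Fin 1 => if i.val + j.val + 1 = 1 then (1 : L) else 0)).Local v)) := hαst.2 _ (hgood u) b (hst_trans (hst_symm hu) hab)
          rw [if_pos hc, if_pos hb, finTau_eq_of_isLocalStablyConjH L v hab μ, finKappaAt_eq_of_isLocalStablyConjH L v (qsForm L) hab, hDHst a b ha hab, hαb, hαa]
        · have hb : ¬ (IsLocalGRegular L v b ∧ IsLocalNormPair L (qsForm L) v b ((eT T i s : ↥(Subgroup.centralizer ({γc T i} : Set (Gqs L v)))) : Gqs L v)) := fun hb =>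
            hc ⟨ha, (isLocalNormPair_iff_of_isLocalStablyConjH L v (qsForm L) hab _).1 hb.2⟩
          rw [if_neg hc, if_neg hb]
      · obtain ⟨u, -, rfl⟩ := Finset.mem_image.1 ht
        exact ⟨hσreg T hT u s hs, hσR T hT u i s hs⟩
      · obtain ⟨u, -, rfl⟩ := Finset.mem_image.1 ht
        obtain ⟨u', -, rfl⟩ := Finset.mem_image.1 ht'
        exact hσpair T hT s hs u u' (fun h => hne (by rw [h]))
      · obtain ⟨u, hu⟩ := hσexh T hT i s hs a ha hR
        exact ⟨(σ T u s : ((UnitaryGroup.cmDatum L 2 (Matrix.of fun i j : Fin 2 => if i.val + j.val + 1 = 2 then (1 : L) else 0)).Local v × (UnitaryGroup.cmDatum L 1 (Matrix.of fun i j : Fin 1 => if i.val + j.val + 1 = 1 then (1 : L) else 0)).Local v)), Finset.mem_image.2 ⟨u, Finset.mem_univ u, rfl⟩, hu⟩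
    -- the summand of (P2σ), named
    set S : Fin (cQ T) → Fin (n T) → ℂ := fun u i => (dG ((eT T i s : ↥(Subgroup.centralizer ({γc T i} : Set (Gqs L v)))) : Gqs L v) : ℂ) *
        (finTau L v (σ T u s).1 μ * (dH (σ T u s).1 : ℂ) * ((finKappaAt L v (qsForm L) (σ T u s).1 ((eT T i s : ↥(Subgroup.centralizer ({γc T i} : Set (Gqs L v)))) : Gqs L v) : ℤ) : ℂ) * α (σ T u s).1) *
        classOrbitalIntegral mQv f (ConjClasses.mk ((eT T i s : ↥(Subgroup.centralizer ({γc T i} : Set (Gqs L v)))) : Gqs L v)) with hSdef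
    have hΦi : ∀ i : Fin (n T), Φ ((eT T i s : ↥(Subgroup.centralizer ({γc T i} : Set (Gqs L v)))) : Gqs L v) = ∑ u : Fin (cQ T), S u i := by
      intro i
      show ((dG ((eT T i s : ↥(Subgroup.centralizer ({γc T i} : Set (Gqs L v)))) : Gqs L v) : ℂ)) ^ 2 * up ((eT T i s : ↥(Subgroup.centralizer ({γc T i} : Set (Gqs L v)))) : Gqs L v) * classOrbitalIntegral mQv f (ConjClasses.mk ((eT T i s : ↥(Subgroup.centralizer ({γc T i} : Set (Gqs L v)))) : Gqs L v)) = _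
      rw [hupi i, sq_mul_inv_mul_mul, Finset.mul_sum, Finset.sum_mul]
    have hSu : ∀ u : Fin (cQ T), ∑ i : Fin (n T), S u i = F ((σ T u s) : ((UnitaryGroup.cmDatum L 2 (Matrix.of fun i j : Fin 2 => if i.val + j.val + 1 = 2 then (1 : L) else 0)).Local v × (UnitaryGroup.cmDatum L 1 (Matrix.of fun i j : Fin 1 => if i.val + j.val + 1 = 1 then (1 : L) else 0)).Local v)) := fun u => hP2σ T hT u s hs
    calc ∑ i : Fin (n T), Φ ((eT T i s : ↥(Subgroup.centralizer ({γc T i} : Set (Gqs L v)))) : Gqs L v)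
        = ∑ i : Fin (n T), ∑ u : Fin (cQ T), S u i := Finset.sum_congr rfl fun i _ => hΦi i
      _ = ∑ u : Fin (cQ T), ∑ i : Fin (n T), S u i := Finset.sum_comm
      _ = ∑ u : Fin (cQ T), F ((σ T u s) : ((UnitaryGroup.cmDatum L 2 (Matrix.of fun i j : Fin 2 => if i.val + j.val + 1 = 2 then (1 : L) else 0)).Local v × (UnitaryGroup.cmDatum L 1 (Matrix.of fun i j : Fin 1 => if i.val + j.val + 1 = 1 then (1 : L) else 0)).Local v)) := Finset.sum_congr rfl fun u _ => hSu u
  -- ### (v) integrate: `Σ_i ∫ Φ∘e_i = ∫ Σ_i Φ∘e_i = Σ_u ∫ F∘σ_u = cQ T · ∫ F`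
  rw [← integral_finsetSum Finset.univ (fun i _ => hint i)]
  rw [integral_congr_ae (hae.mono fun s hs => hpt s hs)]
  have hFσ : ∀ u : Fin (cQ T), Integrable (fun s : ↥T => F ((σ T u s) : ((UnitaryGroup.cmDatum L 2 (Matrix.of fun i j : Fin 2 => if i.val + j.val + 1 = 2 then (1 : L) else 0)).Local v × (UnitaryGroup.cmDatum L 1 (Matrix.of fun i j : Fin 1 => if i.val + j.val + 1 = 1 then (1 : L) else 0)).Local v))) (tH T) :=
    fun u => ((hσm T hT u).integrable_comp hFint.aestronglyMeasurable).2 hFint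
  have hIσ : ∀ u : Fin (cQ T), ∫ s : ↥T, F ((σ T u s) : ((UnitaryGroup.cmDatum L 2 (Matrix.of fun i j : Fin 2 => if i.val + j.val + 1 = 2 then (1 : L) else 0)).Local v × (UnitaryGroup.cmDatum L 1 (Matrix.of fun i j : Fin 1 => if i.val + j.val + 1 = 1 then (1 : L) else 0)).Local v)) ∂(tH T) = ∫ s : ↥T, F (s : ((UnitaryGroup.cmDatum L 2 (Matrix.of fun i j : Fin 2 => if i.val + j.val + 1 = 2 then (1 : L) else 0)).Local v × (UnitaryGroup.cmDatum L 1 (Matrix.of fun i j : Fin 1 => if i.val + j.val + 1 = 1 then (1 : L) else 0)).Local v)) ∂(tH T) := by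
    intro u
    have h := integral_map (hσm T hT u).measurable.aemeasurable (f := fun s : ↥T => F (s : ((UnitaryGroup.cmDatum L 2 (Matrix.of fun i j : Fin 2 => if i.val + j.val + 1 = 2 then (1 : L) else 0)).Local v × (UnitaryGroup.cmDatum L 1 (Matrix.of fun i j : Fin 1 => if i.val + j.val + 1 = 1 then (1 : L) else 0)).Local v))) (by rw [(hσm T hT u).map_eq]; exact hFint.aestronglyMeasurable)
    rw [(hσm T hT u).map_eq] at h
    exact h.symm
  rw [integral_finsetSum Finset.univ (fun u _ => hFσ u), Finset.sum_congr rfl fun u _ => hIσ u, Finset.sum_const, Finset.card_univ, Fintype.card_fin, nsmul_eq_mul]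
  -- ### (vi) the scalars
  exact weight_mul_card_mul_eq ((T.subgroupOf (Subgroup.normalizer (T : Set ((UnitaryGroup.cmDatum L 2 (Matrix.of fun i j : Fin 2 => if i.val + j.val + 1 = 2 then (1 : L) else 0)).Local v × (UnitaryGroup.cmDatum L 1 (Matrix.of fun i j : Fin 1 => if i.val + j.val + 1 = 1 then (1 : L) else 0)).Local v)))).index) (m T) (cQ T) hc0 _

end CM

end Summit.HodgeConjecture.HodgeConjecture.Cruxes.H413.F0P3cStCharTSUpTrSlotTransport

end
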